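import Literature.Analysis.FluidPDE.SteadyLiouvilleCriteria
import HarnessLib

/-!
# Liouville theorem for steady Navier–Stokes flows with critically decaying vorticity (Wu 2026, PREPRINT)

Topic `Literature/Analysis/FluidPDE`; ONE named fact (a result CLAIMED in print, `def … : Prop`,
D-0014), filed at the request of DIRECTOR-NS (cell ns-regularity-ideate, bus #40, 2026-08-27) for
item `stmt-NavierStokesRegularity-0897` = route decl `GaldiLiouvilleGate.CriticalRateLiouville`
("Liouville at Galdi's critical rate, arbitrary constants"), which the companion file
`SteadyLiouvilleCriteria.lean` (module docstring, 2026-08-15) recorded as NOT in print.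

**PROVENANCE FLAG — read before use.** Source: Wangzhe Wu, *The Global Weak-Lorentz Vorticity
Endpoint in the Stationary Navier–Stokes Liouville Problem*, arXiv:2608.22471v1 (23 Aug 2026),
27 pp., single author, UNREFEREED as of 2026-08-27; p. 27 declares generative-AI assistance for
"language editing, organization of the exposition, and preliminary checks of intermediate
calculations and mathematical arguments". One in-house referee-style read of the whole proof spine
(evidence `WU2026-SPINE-0897.md` on the item, 2026-08-27) located no unproved load-bearing step; that
is one reader, not a refereeing. Per D-0014 the result is vendored ONLY as a hypothesis (a named
`Prop`, no `_holds`); an item closed through it is closed CONDITIONALLY on this fact and must say so.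

**Statements (verbatim, p. 2).** Theorem 1.1: "Let `(v, p)` be a smooth solution of (1.1)
[`−Δv + (v·∇)v + ∇p = 0`, `div v = 0`] in `ℝ³` such that `v(x) → 0` as `|x| → ∞`, and let
`ω = curl v`. If `ω ∈ L^{9/5,∞}(ℝ³)`, then `v ≡ 0`." Corollary 1.2: "Let `(v, p)` be a smooth solution
of (1.1) in `ℝ³` such that `v(x) → 0` as `|x| → ∞`. If `E_ω := limsup_{|x|→∞} |x|^{5/3} |curl v(x)| < ∞`,
then `v ≡ 0`." (No smallness; finite Dirichlet energy is not assumed — it is derived, Lemma 2.1, from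
Seregin–Wang 2020 Thm 1.1 (i) = `SereginWang2020_annular_liouville`.) Proof spine: Biot–Savart +
Lorentz HLS; logarithmic layer-cake bound `∫_{1<|x|<R} |ω|^{9/5} ≤ C(1 + log R)` and dyadic scale
selection; inviscid blow-down `V_R(y) = R^{2/3} v(Ry)` (viscosity `R^{-1/3} → 0`) to a steady Euler
tangent with canonical pressure `P = R_iR_k(V_iV_k)`; Bernoulli companion laws `div(β(Q)V) = 0`,
`Q = P + |V|²/2`, on `{|y| > 1}`; a cubic truncation forces the tangent Bernoulli flux to vanish; the
harmonic-cutoff identity `∫ Φ_R |∇v|² + (2R)⁻¹ ∮_{S_R} |v|² = −R ∫_{|x|>R} 𝒬 v·x/|x|³`, exactly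
scale-invariant at the rate `2/3`, transfers this to `∫ |∇v|² = 0`.

## Rendering choices (as in `SteadyLiouvilleCriteria.lean`)

* We vendor COROLLARY 1.2 (the pointwise critical rate), not Theorem 1.1: the tree has no Lorentz
  (weak-Lebesgue) spaces. `-- TODO(general form): Thm 1.1 assumes only curl v ∈ L^{9/5,∞}(ℝ³)`.
* "smooth steady solution" = `IsLerayProfile ν 0 U P` + `ContDiff ℝ ∞` of `U` and `P`;
  `v → 0` = `Tendsto U (cocompact _) (𝓝 0)`.
* For a CONTINUOUS field, `limsup_{|x|→∞} |x|^{5/3}|curl U(x)| < ∞` is equivalent to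
  `∃ C, ∀ x, ‖curl U x‖ ≤ C (1 + ‖x‖)^{-5/3}` (boundedness on balls); we state the latter, the form
  used by the route decl.
* Viscosity: the source prints `ν = 1`; stated for every `ν > 0`, equivalent by `U ↦ ν⁻¹U`,
  `P ↦ ν⁻²P` (the decay hypothesis is invariant up to the constant), exactly as the module
  docstring of `SteadyLiouvilleCriteria.lean` explains; nothing else is generalised.

## References

* W. Wu, arXiv:2608.22471v1 (2026): Thm 1.1, Cor. 1.2 (p. 2), §3 (proof). [Wu2026]
* G. Seregin, W. Wang, St. Petersburg Math. J. 31 (2020) 387–393: Thm 1.1 (i). [SereginWang2020]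
* H. Kozono, Y. Terasawa, Y. Wakasugi, J. Funct. Anal. 272 (2017) 804–818: Thm 1.1, Cor. 1.3 (the
  criterion `E_ω < ∞ ∧ E_ω³ ≤ δ D(v) ⇒ v ≡ 0` whose smallness clause Cor. 1.2 removes). [KozonoTerasawaWakasugi2017]
-/

noncomputable section

open MeasureTheory Filter Set Metric
open scoped Topology

namespace Literature.Analysis.FluidPDE

/-- **Wu 2026 (PREPRINT arXiv:2608.22471v1, unrefereed), Corollary 1.2 — critical pointwise
vorticity criterion without smallness**: "Let `(v, p)` be a smooth solution of
`−Δv + (v·∇)v + ∇p = 0`, `div v = 0` in `ℝ³` such that `v(x) → 0` as `|x| → ∞`. If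
`limsup_{|x|→∞} |x|^{5/3}|curl v(x)| < ∞`, then `v ≡ 0`." Rendered (module docstring) for every
viscosity `ν > 0` on `IsLerayProfile ν 0 U P` with `U, P ∈ C^∞`, the decay hypothesis as
`‖curl U x‖ ≤ C(1 + ‖x‖)^{-5/3}`. VENDORED AS A HYPOTHESIS ONLY (preprint; see the provenance flag in
the module docstring); implies the route decl `GaldiLiouvilleGate.CriticalRateLiouville` of
`NavierStokesRegularity` (`U → 0` from the rate `‖U‖ ≤ C⟨y⟩^{-2/3}`, `‖curl U‖ ≤ ‖curlCLM‖ ‖DU‖ ≤ C'⟨y⟩^{-5/3}`;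
reduction file attached as evidence on item `stmt-NavierStokesRegularity-0897`). [cite: Wu2026, Cor. 1.2] -/
def Wu2026_critical_vorticity_liouville : Prop :=
  ∀ ν : ℝ, 0 < ν →
    ∀ (U : EuclideanSpace ℝ (Fin 3) → EuclideanSpace ℝ (Fin 3)) (P : EuclideanSpace ℝ (Fin 3) → ℝ),
      IsLerayProfile ν 0 U P → ContDiff ℝ (⊤ : ℕ∞) U → ContDiff ℝ (⊤ : ℕ∞) P →
      Tendsto U (cocompact (EuclideanSpace ℝ (Fin 3))) (𝓝 0) →
      (∃ C : ℝ, ∀ x, ‖curl U x‖ ≤ C * (1 + ‖x‖) ^ (-(5 / 3 : ℝ))) → U = 0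

-- TODO(general form): Wu 2026 Thm 1.1 assumes only `curl U ∈ L^{9/5,∞}(ℝ³)` (weak Lebesgue
-- space); not rendered — no Lorentz spaces in the tree.

end Literature.Analysis.FluidPDE
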